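import Mathlib
import HarnessLib
import Summits.Langlands.Langlands.Theses.EvenSkinnerWilesMirror
import Summits.Langlands.Langlands.Theorems.EvenSkinnerWilesMirrorDeterminantParityCharacters
import Literature.NumberTheory.EllipticCurves.EisensteinNewformLevelRaisingInertiaProofs
import Literature.NumberTheory.GaloisRepresentations.LocalKroneckerWeberInertiaProofs

/-!
# `EvenSkinnerWilesMirror.DeterminantParity` — proof of the crux (item `stmt-Langlands-15311`)

**Statement** (route `EvenSkinnerWilesMirror`, crux `DeterminantParity`): for `p` odd and a
continuous `ρ : Γ_ℚ → GL₂(ℚ̄_p)` that is unramified almost everywhere and *ordinary of weight `k`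
up to `m`-th powers* at `p` (in some frame the decomposition group at `p` is upper triangular, and
on inertia the diagonal entries satisfy `a₁₁^m = 1`, `a₀₀^m = ε^{(k-1)m}`), the character
`det ρ · ε^{1-k}` has finite order: `det ρ(g)^N = ε(g)^{(k-1)N}` for some `N > 0` and all `g`.
Closing theorem (by name): `determinantParity_proof`.

**Proof.**  Let `χ = det ρ · ε^{-(k-1)} : Γ_ℚ → ℚ̄_pˣ` (`exists_twistedDet`), a character with
continuous underlying function.  It is killed by a positive power on every inertia group:
* at the place `p`: `χ^m = 1` on `I_𝔓` for every `𝔓 ∣ p` — the ordinary frame gives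
  `det = a₀₀ a₁₁` on the inertia group of the completion, which maps onto `I_{𝔓₀}` for the prime
  `𝔓₀` of the chosen embedding (`exists_primesAbove_forall_inertia_absGaloisRestrict`), and the
  other primes above `p` are conjugate (`exists_smul_eq_of_mem_primesAbove_holds`);
* at an unramified place `v ∤ p`: `χ = 1` on `I_𝔓` (`ρ` and `ε` are both unramified);
* at a ramified place `ℓ ≠ p` (finitely many): some `χ^{N_ℓ} = 1` on `I_𝔓`, `𝔓 ∣ ℓ`
  (`exists_pow_eq_one_of_forall_inertia`: Kronecker–Weber at finite level + an ultrametric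
  separation argument).
Hence `χ^N`, `N = m · ∏ N_ℓ`, is unramified everywhere, so `χ^N = 1` by Minkowski's theorem
(`eq_one_of_forall_inertia`).  No conjecture or named fact is used; no definition is introduced.
Ref: Serre, *Abelian ℓ-adic representations* (1968), Ch. III §1–§2 (locally algebraic abelian
representations of `Γ_ℚ` are powers of the cyclotomic character up to finite order);
Washington, *Cyclotomic Fields*, Thm. 14.1. (decomp-langlands lens-2, g29: the «special»
(ordinary, a.e. unramified) side of the special/generic dichotomy for `det ρ`.)
-/

set_option linter.dupNamespace false -- project-wide option (lakefile weak.linter.dupNamespace); `Summit.Langlands.Langlands` is the mandated namespace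

namespace Summit.Langlands.Langlands.Theorems.EvenSkinnerWilesMirrorDeterminantParity

open Field NumberField IsDedekindDomain
open Literature.NumberTheory.GaloisRepresentations
open Literature.NumberTheory.EllipticCurves

variable {p : ℕ} [Fact p.Prime]

/-- `ι(ε_p(g)) ≠ 0` in `ℚ̄_p`. [folklore] -/
theorem algebraMap_cyclotomicCharacter_ne_zero {K : Type*} [Field K] (g : absoluteGaloisGroup K) :
    algebraMap ℚ_[p] (PadicAlgCl p)
        (((GaloisRep.cyclotomicCharacter K p g : ℤ_[p]ˣ) : ℤ_[p]) : ℚ_[p]) ≠ 0 := by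
  rw [← norm_ne_zero_iff, PadicAlgCl.norm_extends, ← PadicInt.norm_def, PadicInt.norm_units]
  exact one_ne_zero

/-- The **twisted determinant** `χ = det ρ · ε^{-(k-1)} : Γ_ℚ → ℚ̄_pˣ` exists as a character
with the displayed values `χ(g) = det ρ(g) · (ι ε(g))^{-(k-1)}` (an existence statement, so that
the proof files introduce no new definitions). [folklore] -/
theorem exists_twistedDet (ρ : FramedGaloisRep ℚ (PadicAlgCl p) 2) (k : ℕ) :
    ∃ χ : absoluteGaloisGroup ℚ →* (PadicAlgCl p)ˣ, ∀ g : absoluteGaloisGroup ℚ,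
      ((χ g : (PadicAlgCl p)ˣ) : PadicAlgCl p) =
        ((ρ g : GL (Fin 2) (PadicAlgCl p)) : Matrix (Fin 2) (Fin 2) (PadicAlgCl p)).det *
          ((algebraMap ℚ_[p] (PadicAlgCl p)
            (((GaloisRep.cyclotomicCharacter ℚ p g : ℤ_[p]ˣ) : ℤ_[p]) : ℚ_[p])) ^ (k - 1))⁻¹ := by
  let φ : ℤ_[p] →* PadicAlgCl p :=
    (((algebraMap ℚ_[p] (PadicAlgCl p)).comp (PadicInt.Coe.ringHom (p := p)) :
      ℤ_[p] →+* PadicAlgCl p) : ℤ_[p] →* PadicAlgCl p)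
  let e : absoluteGaloisGroup ℚ →* (PadicAlgCl p)ˣ :=
    (Units.map φ).comp (GaloisRep.cyclotomicCharacter ℚ p).toMonoidHom
  have he : ∀ g : absoluteGaloisGroup ℚ, ((e g : (PadicAlgCl p)ˣ) : PadicAlgCl p) =
      algebraMap ℚ_[p] (PadicAlgCl p)
        (((GaloisRep.cyclotomicCharacter ℚ p g : ℤ_[p]ˣ) : ℤ_[p]) : ℚ_[p]) := fun _ => rfl
  refine ⟨(Matrix.GeneralLinearGroup.det.comp ρ.toMonoidHom) * (e ^ (k - 1))⁻¹, fun g => ?_⟩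
  rw [MonoidHom.mul_apply, MonoidHom.inv_apply, MonoidHom.pow_apply, Units.val_mul,
    Units.val_inv_eq_inv_val, Units.val_pow_eq_pow_val, MonoidHom.comp_apply,
    Matrix.GeneralLinearGroup.val_det_apply, he]
  rfl

/-- The underlying function of the twisted determinant is continuous. [folklore] -/
theorem continuous_val_of_twistedDet (ρ : FramedGaloisRep ℚ (PadicAlgCl p) 2) (k : ℕ)
    (χ : absoluteGaloisGroup ℚ →* (PadicAlgCl p)ˣ)
    (hχ : ∀ g : absoluteGaloisGroup ℚ, ((χ g : (PadicAlgCl p)ˣ) : PadicAlgCl p) =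
      ((ρ g : GL (Fin 2) (PadicAlgCl p)) : Matrix (Fin 2) (Fin 2) (PadicAlgCl p)).det *
        ((algebraMap ℚ_[p] (PadicAlgCl p)
          (((GaloisRep.cyclotomicCharacter ℚ p g : ℤ_[p]ˣ) : ℤ_[p]) : ℚ_[p])) ^ (k - 1))⁻¹) :
    Continuous fun g => ((χ g : (PadicAlgCl p)ˣ) : PadicAlgCl p) := by
  have h1 : Continuous fun g : absoluteGaloisGroup ℚ =>
      ((ρ g : GL (Fin 2) (PadicAlgCl p)) : Matrix (Fin 2) (Fin 2) (PadicAlgCl p)).det :=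
    (Units.continuous_val.comp (map_continuous ρ)).matrix_det
  have h2 : Continuous fun g : absoluteGaloisGroup ℚ => algebraMap ℚ_[p] (PadicAlgCl p)
      (((GaloisRep.cyclotomicCharacter ℚ p g : ℤ_[p]ˣ) : ℤ_[p]) : ℚ_[p]) :=
    (continuous_algebraMap ℚ_[p] (PadicAlgCl p)).comp
      ((continuous_subtype_val : Continuous fun x : ℤ_[p] => (x : ℚ_[p])).comp
        ((Units.continuous_val : Continuous fun u : ℤ_[p]ˣ => (u : ℤ_[p])).comp
          (map_continuous (GaloisRep.cyclotomicCharacter ℚ p))))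
  rw [show (fun g => ((χ g : (PadicAlgCl p)ˣ) : PadicAlgCl p)) = fun g =>
      ((ρ g : GL (Fin 2) (PadicAlgCl p)) : Matrix (Fin 2) (Fin 2) (PadicAlgCl p)).det *
        ((algebraMap ℚ_[p] (PadicAlgCl p)
          (((GaloisRep.cyclotomicCharacter ℚ p g : ℤ_[p]ˣ) : ℤ_[p]) : ℚ_[p])) ^ (k - 1))⁻¹ from
    funext hχ]
  exact h1.mul ((h2.pow _).inv₀ fun g => pow_ne_zero _ (algebraMap_cyclotomicCharacter_ne_zero g))

/-- From `χ(g)^N = 1` to the determinant identity `det ρ(g)^N = ι(ε(g))^{(k-1)N}`. [folklore] -/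
theorem det_pow_eq_of_twistedDet_pow_eq_one (ρ : FramedGaloisRep ℚ (PadicAlgCl p) 2) (k : ℕ)
    (χ : absoluteGaloisGroup ℚ →* (PadicAlgCl p)ˣ)
    (hχ : ∀ g : absoluteGaloisGroup ℚ, ((χ g : (PadicAlgCl p)ˣ) : PadicAlgCl p) =
      ((ρ g : GL (Fin 2) (PadicAlgCl p)) : Matrix (Fin 2) (Fin 2) (PadicAlgCl p)).det *
        ((algebraMap ℚ_[p] (PadicAlgCl p)
          (((GaloisRep.cyclotomicCharacter ℚ p g : ℤ_[p]ˣ) : ℤ_[p]) : ℚ_[p])) ^ (k - 1))⁻¹)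
    {g : absoluteGaloisGroup ℚ} {N : ℕ} (h : χ g ^ N = 1) :
    ((Matrix.GeneralLinearGroup.det (ρ g) : (PadicAlgCl p)ˣ) : PadicAlgCl p) ^ N =
      algebraMap ℚ_[p] (PadicAlgCl p)
        (((GaloisRep.cyclotomicCharacter ℚ p g : ℤ_[p]ˣ) : ℤ_[p]) : ℚ_[p]) ^ ((k - 1) * N) := by
  have h' := congrArg (fun u : (PadicAlgCl p)ˣ => (u : PadicAlgCl p)) h
  simp only [Units.val_pow_eq_pow_val, hχ, Units.val_one, mul_pow, inv_pow, ← pow_mul] at h'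
  rw [Matrix.GeneralLinearGroup.val_det_apply]
  exact (mul_inv_eq_one₀ (pow_ne_zero _ (algebraMap_cyclotomicCharacter_ne_zero g))).mp h'

/-- **Unramified places.**  At a place `v ∤ p` where `ρ` is unramified, `χ` is trivial on every
inertia group above `v` (`ρ(I_𝔓) = 1` and `ε_p(I_𝔓) = 1`). [folklore] -/
theorem twistedDet_eq_one_of_isUnramifiedAt (ρ : FramedGaloisRep ℚ (PadicAlgCl p) 2) (k : ℕ)
    (χ : absoluteGaloisGroup ℚ →* (PadicAlgCl p)ˣ)
    (hχ : ∀ g : absoluteGaloisGroup ℚ, ((χ g : (PadicAlgCl p)ˣ) : PadicAlgCl p) =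
      ((ρ g : GL (Fin 2) (PadicAlgCl p)) : Matrix (Fin 2) (Fin 2) (PadicAlgCl p)).det *
        ((algebraMap ℚ_[p] (PadicAlgCl p)
          (((GaloisRep.cyclotomicCharacter ℚ p g : ℤ_[p]ˣ) : ℤ_[p]) : ℚ_[p])) ^ (k - 1))⁻¹)
    {v : HeightOneSpectrum (𝓞 ℚ)} (hv : (p : 𝓞 ℚ) ∉ v.asIdeal) (hur : ρ.IsUnramifiedAt v) :
    ∀ 𝔓 ∈ v.primesAbove, ∀ τ ∈ 𝔓.inertia (absoluteGaloisGroup ℚ), χ τ = 1 := by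
  intro 𝔓 h𝔓 τ hτ
  have h1 : ρ τ = 1 := hur 𝔓 h𝔓 τ hτ
  have h2 : GaloisRep.cyclotomicCharacter ℚ p τ = 1 :=
    Hida2000Thm326.cyclotomicCharacter_eq_one_of_mem_inertia hv h𝔓 hτ
  refine Units.ext ?_
  rw [hχ, h1, h2, Units.val_one, Units.val_one, Matrix.det_one, Units.val_one,
    PadicInt.coe_one, map_one, one_pow, inv_one, mul_one]

/-- **The place `p` (ordinary frame).**  If in some frame the decomposition group of the completion
at `v ∣ p` is upper triangular with `a₁₁^m = 1` and `a₀₀^m = ε^{(k-1)m}` on inertia, then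
`χ^m = 1` on the inertia group of *every* prime `𝔓 ∣ p` of `ℤ̄` (transport along
`Γ_{ℚ_v} → Γ_ℚ` onto `I_{𝔓₀}`, then conjugate). [folklore] -/
theorem twistedDet_pow_eq_one_of_ordinary (ρ : FramedGaloisRep ℚ (PadicAlgCl p) 2) (k m : ℕ)
    (χ : absoluteGaloisGroup ℚ →* (PadicAlgCl p)ˣ)
    (hχ : ∀ g : absoluteGaloisGroup ℚ, ((χ g : (PadicAlgCl p)ˣ) : PadicAlgCl p) =
      ((ρ g : GL (Fin 2) (PadicAlgCl p)) : Matrix (Fin 2) (Fin 2) (PadicAlgCl p)).det *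
        ((algebraMap ℚ_[p] (PadicAlgCl p)
          (((GaloisRep.cyclotomicCharacter ℚ p g : ℤ_[p]ˣ) : ℤ_[p]) : ℚ_[p])) ^ (k - 1))⁻¹)
    {v : HeightOneSpectrum (𝓞 ℚ)}
    (hord : ∃ Q : Matrix.GeneralLinearGroup (Fin 2) (PadicAlgCl p), ∀ σ,
      (Q⁻¹ * ρ.toLocal v σ * Q).val 1 0 = 0 ∧
      (σ ∈ absInertia (v.adicCompletion ℚ) →
        (Q⁻¹ * ρ.toLocal v σ * Q).val 1 1 ^ m = 1 ∧
        (Q⁻¹ * ρ.toLocal v σ * Q).val 0 0 ^ m = algebraMap (Padic p) (PadicAlgCl p)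
          (((GaloisRep.cyclotomicCharacter (v.adicCompletion ℚ) p σ).val : PadicInt p) : Padic p)
            ^ ((k - 1) * m))) :
    ∀ 𝔓 ∈ v.primesAbove, ∀ τ ∈ 𝔓.inertia (absoluteGaloisGroup ℚ), χ τ ^ m = 1 := by
  obtain ⟨Q, hQ⟩ := hord
  obtain ⟨𝔓₀, h𝔓₀, hlift, -⟩ :=
    Hida2000Thm326.exists_primesAbove_forall_inertia_absGaloisRestrict ℚ v
  intro 𝔔 h𝔔 τ hτ
  -- conjugate `τ` into `I_{𝔓₀}` and lift it to the local inertia group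
  obtain ⟨g₀, hg₀⟩ := HeightOneSpectrum.exists_smul_eq_of_mem_primesAbove_holds h𝔓₀ h𝔔
  have hτ' : g₀⁻¹ * τ * g₀ ∈ 𝔓₀.inertia (absoluteGaloisGroup ℚ) := by
    refine (Ideal.conj_mem_inertia_smul_iff 𝔓₀ g₀ _).mp ?_
    rw [hg₀, show g₀ * (g₀⁻¹ * τ * g₀) * g₀⁻¹ = τ by group]
    exact hτ
  obtain ⟨s, hsI, hsres⟩ := hlift _ hτ'
  obtain ⟨h10, hs⟩ := hQ s
  obtain ⟨h11, h00⟩ := hs hsI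
  have hconj : χ (g₀⁻¹ * τ * g₀) = χ τ := by
    rw [map_mul, map_mul, map_inv, inv_mul_cancel_comm]
  rw [← hconj]
  -- the determinant in the ordinary frame
  set M : Matrix.GeneralLinearGroup (Fin 2) (PadicAlgCl p) := Q⁻¹ * ρ.toLocal v s * Q with hM
  have h10' : (M : Matrix (Fin 2) (Fin 2) (PadicAlgCl p)) 1 0 = 0 := h10
  have hdet : ((ρ (g₀⁻¹ * τ * g₀) : GL (Fin 2) (PadicAlgCl p)) :
      Matrix (Fin 2) (Fin 2) (PadicAlgCl p)).det =
      (M : Matrix (Fin 2) (Fin 2) (PadicAlgCl p)) 0 0 *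
        (M : Matrix (Fin 2) (Fin 2) (PadicAlgCl p)) 1 1 := by
    have h1 : ((M : GL (Fin 2) (PadicAlgCl p)) : Matrix (Fin 2) (Fin 2) (PadicAlgCl p)).det =
        ((ρ (g₀⁻¹ * τ * g₀) : GL (Fin 2) (PadicAlgCl p)) :
          Matrix (Fin 2) (Fin 2) (PadicAlgCl p)).det := by
      rw [hM, Units.val_mul, Units.val_mul, Matrix.det_units_conj', FramedGaloisRep.toLocal_apply,
        hsres]
    rw [← h1, Matrix.det_fin_two, h10', mul_zero, sub_zero]
  -- the cyclotomic character along the restriction `Γ_{ℚ_v} → Γ_ℚ`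
  have hε : GaloisRep.cyclotomicCharacter ℚ p (g₀⁻¹ * τ * g₀) =
      GaloisRep.cyclotomicCharacter (v.adicCompletion ℚ) p s := by
    rw [← hsres, cyclotomicCharacter_absGaloisRestrict]
  refine Units.ext ?_
  rw [Units.val_pow_eq_pow_val, hχ, Units.val_one, hdet, hε, mul_pow, mul_pow, inv_pow,
    ← pow_mul]
  have h00' : (M : Matrix (Fin 2) (Fin 2) (PadicAlgCl p)) 0 0 ^ m = algebraMap ℚ_[p] (PadicAlgCl p)
      (((GaloisRep.cyclotomicCharacter (v.adicCompletion ℚ) p s : ℤ_[p]ˣ) : ℤ_[p]) : ℚ_[p])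
        ^ ((k - 1) * m) := h00
  have h11' : (M : Matrix (Fin 2) (Fin 2) (PadicAlgCl p)) 1 1 ^ m = 1 := h11
  rw [h00', h11', mul_one]
  exact mul_inv_cancel₀ (pow_ne_zero _ (algebraMap_cyclotomicCharacter_ne_zero s))

/-- **`DeterminantParity`** (crux of `EvenSkinnerWilesMirror`, item `stmt-Langlands-15311`):
for an odd prime `p` and a continuous, almost everywhere unramified `ρ : Γ_ℚ → GL₂(ℚ̄_p)` that is
ordinary of weight `k` up to `m`-th powers at `p`, the character `det ρ · ε^{1-k}` has finite
order.  Proof: the twisted determinant `χ` is killed by a positive power on every inertia group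
(`twistedDet_pow_eq_one_of_ordinary` at `p`, `twistedDet_eq_one_of_isUnramifiedAt` at the
unramified places, `exists_pow_eq_one_of_forall_inertia` at the finitely many ramified `ℓ ≠ p`),
so a positive power `χ^N` is unramified everywhere and hence trivial
(`eq_one_of_forall_inertia`, Minkowski).
Ref: Serre (1968), Ch. III §1–§2; Washington, *Cyclotomic Fields*, Thm. 14.1. [folklore] -/
theorem determinantParity_proof :
    Summit.Langlands.Langlands.Theses.EvenSkinnerWilesMirror.DeterminantParity := by
  intro p _ _hp2 ρ hunr k m _hk hm hord
  obtain ⟨χ, hχ⟩ := exists_twistedDet ρ k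
  have hχc := continuous_val_of_twistedDet ρ k χ hχ
  -- the finitely many ramified places
  have hS : {v : HeightOneSpectrum (𝓞 ℚ) | ¬ ρ.IsUnramifiedAt v}.Finite :=
    Filter.eventually_cofinite.mp hunr
  -- local exponents away from `p`
  have hloc : ∀ v : HeightOneSpectrum (𝓞 ℚ), ∃ N : ℕ, 0 < N ∧ ((p : 𝓞 ℚ) ∉ v.asIdeal →
      ∀ 𝔓 ∈ v.primesAbove, ∀ τ ∈ 𝔓.inertia (absoluteGaloisGroup ℚ), χ τ ^ N = 1) := by
    intro v
    by_cases hv : (p : 𝓞 ℚ) ∈ v.asIdeal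
    · exact ⟨1, one_pos, fun h => absurd hv h⟩
    · obtain ⟨N, hN, h⟩ := exists_pow_eq_one_of_forall_inertia χ hχc hv
      exact ⟨N, hN, fun _ => h⟩
  choose Nv hNv_pos hNv using hloc
  -- the global exponent
  refine ⟨m * ∏ v ∈ hS.toFinset, Nv v,
    Nat.mul_pos hm (Finset.prod_pos fun v _ => hNv_pos v), fun g => ?_⟩
  have hkill : ∀ v : HeightOneSpectrum (𝓞 ℚ), ∀ 𝔓 ∈ v.primesAbove,
      ∀ τ ∈ 𝔓.inertia (absoluteGaloisGroup ℚ), (χ ^ (m * ∏ v ∈ hS.toFinset, Nv v)) τ = 1 := by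
    intro v 𝔓 h𝔓 τ hτ
    rw [MonoidHom.pow_apply]
    by_cases hv : (p : 𝓞 ℚ) ∈ v.asIdeal
    · rw [pow_mul, twistedDet_pow_eq_one_of_ordinary ρ k m χ hχ (hord v hv) 𝔓 h𝔓 τ hτ, one_pow]
    · by_cases hvS : v ∈ hS.toFinset
      · obtain ⟨c, hc⟩ : Nv v ∣ m * ∏ v ∈ hS.toFinset, Nv v :=
          dvd_mul_of_dvd_right (Finset.dvd_prod_of_mem _ hvS) m
        rw [hc, pow_mul, hNv v hv 𝔓 h𝔓 τ hτ, one_pow]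
      · have hur : ρ.IsUnramifiedAt v := by
          by_contra h
          exact hvS (hS.mem_toFinset.mpr h)
        rw [twistedDet_eq_one_of_isUnramifiedAt ρ k χ hχ hv hur 𝔓 h𝔓 τ hτ, one_pow]
  have hχNc : Continuous fun g => (((χ ^ (m * ∏ v ∈ hS.toFinset, Nv v)) g :
      (PadicAlgCl p)ˣ) : PadicAlgCl p) := by
    simp only [MonoidHom.pow_apply, Units.val_pow_eq_pow_val]
    exact hχc.pow _
  have hχN : χ ^ (m * ∏ v ∈ hS.toFinset, Nv v) = 1 := eq_one_of_forall_inertia _ hχNc hkill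
  have hg : χ g ^ (m * ∏ v ∈ hS.toFinset, Nv v) = 1 := by
    have h := DFunLike.congr_fun hχN g
    rwa [MonoidHom.pow_apply, MonoidHom.one_apply] at h
  exact det_pow_eq_of_twistedDet_pow_eq_one ρ k χ hχ hg

end Summit.Langlands.Langlands.Theorems.EvenSkinnerWilesMirrorDeterminantParity
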